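import Summits.QuantumFields.YangMills.Theorems.BalabanUVNodesN21MinimiserResponseContraction

/-!
# N21 (NE7c) · THE MINIMISER'S RESPONSE FROM [14] PROP. 6's CONTRACTION — the derivative binder `‖D_U T‖ < 1` is
# REDUNDANT at an INTERIOR fixed point: file 2's ★★′-c with `hlt` discharged by (115)'s ball being a neighbourhood

Width seat `pub-ymgap-dag-n21-w7` (g0′, harness re-seat; dag-lead WIDTH-209 N21 piece 1 «RADIAL TRANSVERSALITY (α)»,
its [14]-regularity rung), node N21 = NE7c (NOT PRINTED in [Bałaban 1983–89], NOT proved), lane K3⁷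
`SpineGivenEndpointR13SepCoPH` (stmt-QuantumFields-20544, `--kind proof --supports … --as helper`).  File 4 of this seat,
an addendum to file 2 `…N21MinimiserResponseContraction` (p609704 ✓; consumed BY NAME: ★★′-c
`psiClause_plaqReading_of_contractingFamily`), answering referee ref-Q g0 READ-26's consumer remark: «`hlt` follows
from `hlip` whenever `K z` is a neighbourhood of the fixed point (print: (115) closed ball, solution interior by Prop. 6's
`ε₄ = 3B₀C₁B₃ε₁`), so at NODE 00's objects (120)–(121) give it for free — separate binder = conservative».

PRINT.  [14] = T. Bałaban, CMP **102** (1985) 277–309, Prop. 6 pp. 295–296: the space (115) is the CLOSED ball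
`‖A₁‖ ≤ ε₄`; (120)–(121) make the map (116) a contraction on it with constant `4B₀C₄(ε₄ + B₀|B|) < 1`; the solution
(the successive approximations from `0`) has norm `≤ B₀C₁B₃ε₁ + B₀C₄(ε₄ + 2dLB₀C₁ε₁)² ≤ ε₄` by (118) and, for print's
choice `ε₄ = 3B₀C₁B₃ε₁` with `ε₁` small, lies in the OPEN ball — so (115) is a neighbourhood of it.

WHAT IS PROVED ([textbook]; 0 def, 0 sorry).
* §1 `norm_fderiv_lt_one_of_lipschitzOn_nhds` — the converse mean-value inequality: `K ∈ 𝓝 x`, `T` `q`-Lipschitz on `K`,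
  `q < 1` ⇒ `‖D T(x)‖ < 1` (`≤ max q 0`; Mathlib `norm_fderiv_le_of_lip'`, no differentiability assumed).
* §2 ★★′-c♮ `psiClause_plaqReading_of_contractingFamily_of_nhds` — file 2's ★★′-c (= n21-w3 f8's NODE-O clause `hΨd`
  VERBATIM on the regular set) with the binder `hlt : ‖D_U T‖ < 1` REPLACED by interiority `hK : K z ∈ 𝓝 (Umin z V)`;
  binders left: `hfix` ((115)∕(116)), `hlip` ((120)–(121)), `hT` (joint analyticity), `hK`, `hunit`.
* §3 A2∕A6 `contractingFamily_nhds_levelZero_witness` — the modified binder system is jointly inhabited in every `𝔄`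
  (file 2's level-0 family `T z V U = ½U + ½V`, `K z = univ ∈ 𝓝 _`, `q = ½`, `Umin z V = V`; HONESTLY LABELLED level 0).

HONEST FRAMING.  [textbook]∕[bookkeeping]; the identification of `K z` with (115) and of `Umin` with [14]'s minimiser AT
NODE 00's objects is LOCATED, not asserted; (α) NOT PRINTED ∕ NOT proved; nothing of Bałaban's asserted; (M1) ∕ NE7c NOT
PRINTED ∕ NOT proved; N21 NOT discharged; K3⁷ NOT claimed; counts unmoved (typed 28∕28 · discharged 5∕27, A 5∕28);
count-neutral; one finite 𝕋⁴ at fixed ε — the Yang–Mills mass gap (Clay) is NOT proved by any of this: R4 would close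
the conditional finite-𝕋⁴ rung `BalabanLadder.UV` only; nothing continuum ∕ ℝ⁴ ∕ OS ∕ mass gap ∕ Clay.
-/

noncomputable section

open Filter Set Metric
open scoped Topology ContDiff

namespace Summit.QuantumFields.YangMills.Theorems.N21MinimiserResponseContractionInterior

open Summit.QuantumFields.YangMills.Theorems.N21MinimiserResponseContraction
  (psiClause_plaqReading_of_contractingFamily)

/-! ## §1  The converse mean-value inequality at an interior point -/

section Interior

variable {𝒳 : Type*} [NormedAddCommGroup 𝒳] [NormedSpace ℂ 𝒳]

/-- **CONVERSE MEAN-VALUE INEQUALITY AT AN INTERIOR FIXED POINT**: if `K` is a neighbourhood of `x` and `T` is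
`q`-Lipschitz on `K` with `q < 1`, then `‖D T(x)‖ < 1` (`‖D T(x)‖ ≤ max q 0`, Mathlib `norm_fderiv_le_of_lip'`; no
differentiability assumed — `fderiv` is `0` otherwise).  In print: (115) is the closed ball `‖X‖ ≤ ε₄` and Prop. 6's
solution lies in its interior, so (120)–(121) already give the derivative bound. [textbook]
[cite: Balaban1985Variational, (115) p.295, (120)-(121) p.295] -/
theorem norm_fderiv_lt_one_of_lipschitzOn_nhds {K : Set 𝒳} {T : 𝒳 → 𝒳} {q : ℝ} {x : 𝒳} (hK : K ∈ 𝓝 x)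
    (hlip : ∀ y ∈ K, ∀ y' ∈ K, ‖T y - T y'‖ ≤ q * ‖y - y'‖) (hq : q < 1) : ‖fderiv ℂ T x‖ < 1 := by
  have hx : x ∈ K := mem_of_mem_nhds hK
  have hle : ‖fderiv ℂ T x‖ ≤ max q 0 := by
    refine norm_fderiv_le_of_lip' ℂ (le_max_right q 0) ?_
    filter_upwards [hK] with y hy
    exact (hlip y hy x hx).trans (mul_le_mul_of_nonneg_right (le_max_left q 0) (norm_nonneg _))
  exact hle.trans_lt (max_lt hq one_pos)

end Interior

/-! ## §2  File 2's ★★′-c with `hlt` discharged by interiority -/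

section InteriorPsi

variable {𝔄 : Type*} [NormedRing 𝔄] [NormedAlgebra ℂ 𝔄] [CompleteSpace 𝔄] {B : Type*} [Fintype B] {Z : Type*}

/-- ★★′-c♮ **THE PLAQUETTE READINGS OF A CONTRACTING FIXED-POINT BRANCH, `hlt` DISCHARGED BY INTERIORITY** — file 2's
★★′-c (= f8's `hΨd` VERBATIM on `Reg = {V | (∀ b, IsUnit (V b)) ∧ ∀ p ∈ plaqs, ‖∂V(p) − 1‖ < ε}`) with the binder
`hlt : ‖D_U T‖ < 1` REPLACED by `hK : K z ∈ 𝓝 (Umin z V)` (§1): binders left `hfix` ((115)∕(116)), `hlip`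
((120)–(121)), `hT` (joint analyticity at the branch), `hK` (interior solution, Prop. 6), `hunit`.
[cite: Balaban1985Variational, Prop. 6 pp.295-296] [bookkeeping] -/
theorem psiClause_plaqReading_of_contractingFamily_of_nhds {Bf : Type*} [Fintype Bf]
    (plaqs : Finset (B × B × B × B)) (ε : ℝ) (Umin : Z → (B → 𝔄) → (Bf → 𝔄))
    (T : Z → (B → 𝔄) → (Bf → 𝔄) → (Bf → 𝔄)) (K : Z → Set (Bf → 𝔄)) {q : ℝ} (hq : q < 1)
    (hfix : ∀ z, ∀ V ∈ {V : B → 𝔄 | (∀ b, IsUnit (V b)) ∧ ∀ p ∈ plaqs,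
      ‖V p.1 * V p.2.1 * Ring.inverse (V p.2.2.1) * Ring.inverse (V p.2.2.2) - 1‖ < ε},
      Umin z V ∈ K z ∧ T z V (Umin z V) = Umin z V)
    (hlip : ∀ z, ∀ V ∈ {V : B → 𝔄 | (∀ b, IsUnit (V b)) ∧ ∀ p ∈ plaqs,
      ‖V p.1 * V p.2.1 * Ring.inverse (V p.2.2.1) * Ring.inverse (V p.2.2.2) - 1‖ < ε},
      ∀ x ∈ K z, ∀ y ∈ K z, ‖T z V x - T z V y‖ ≤ q * ‖x - y‖)
    (hT : ∀ z, ∀ V ∈ {V : B → 𝔄 | (∀ b, IsUnit (V b)) ∧ ∀ p ∈ plaqs,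
      ‖V p.1 * V p.2.1 * Ring.inverse (V p.2.2.1) * Ring.inverse (V p.2.2.2) - 1‖ < ε},
      ContDiffAt ℂ ω (fun w : (B → 𝔄) × (Bf → 𝔄) => T z w.1 w.2) (V, Umin z V))
    (hK : ∀ z, ∀ V ∈ {V : B → 𝔄 | (∀ b, IsUnit (V b)) ∧ ∀ p ∈ plaqs,
      ‖V p.1 * V p.2.1 * Ring.inverse (V p.2.2.1) * Ring.inverse (V p.2.2.2) - 1‖ < ε}, K z ∈ 𝓝 (Umin z V))
    (hunit : ∀ z, ∀ V ∈ {V : B → 𝔄 | (∀ b, IsUnit (V b)) ∧ ∀ p ∈ plaqs,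
      ‖V p.1 * V p.2.1 * Ring.inverse (V p.2.2.1) * Ring.inverse (V p.2.2.2) - 1‖ < ε}, ∀ b, IsUnit (Umin z V b)) :
    ∀ (q : Bf × Bf × Bf × Bf) (z : Z), DifferentiableOn ℂ
      (fun V => Umin z V q.1 * Umin z V q.2.1 * Ring.inverse (Umin z V q.2.2.1) * Ring.inverse (Umin z V q.2.2.2) - 1)
      {V : B → 𝔄 | (∀ b, IsUnit (V b)) ∧ ∀ p ∈ plaqs,
        ‖V p.1 * V p.2.1 * Ring.inverse (V p.2.2.1) * Ring.inverse (V p.2.2.2) - 1‖ < ε} :=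
  psiClause_plaqReading_of_contractingFamily plaqs ε Umin T K hq hfix hlip hT
    (fun z V hV => norm_fderiv_lt_one_of_lipschitzOn_nhds (hK z V hV) (hlip z V hV) hq) hunit

end InteriorPsi

/-! ## §3  A2∕A6: the modified binder system is jointly inhabited — file 2's level-0 family, `K z = univ` -/

section Witness

variable {𝔄 : Type*} [NormedRing 𝔄] [NormedAlgebra ℂ 𝔄] {B : Type*} [Fintype B] {Z : Type*}

/-- **A2∕A6 — THE LEVEL-0 CONTRACTING FAMILY INHABITS THE BINDER SYSTEM OF ★★′-c♮**: fine variables = block variables,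
`Umin z V = V`, `T z V U = ½U + ½V`, `K z = univ` (a neighbourhood of everything), `q = ½`: `hfix`, `hlip`, `hT` (linear
hence `C^ω`), `hK`, `hunit` hold on the regular set — in EVERY `𝔄`.  HONESTLY LABELLED level 0 (file 2's witness with
`hlt` traded for `hK`); the genuine family is (116)'s map at NODE 00's objects, nothing about it asserted. [bookkeeping] -/
theorem contractingFamily_nhds_levelZero_witness (plaqs : Finset (B × B × B × B)) (ε : ℝ) :
    ∃ (T : Z → (B → 𝔄) → (B → 𝔄) → (B → 𝔄)) (K : Z → Set (B → 𝔄)) (q : ℝ), q < 1 ∧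
      (∀ z : Z, ∀ V ∈ {V : B → 𝔄 | (∀ b, IsUnit (V b)) ∧ ∀ p ∈ plaqs,
          ‖V p.1 * V p.2.1 * Ring.inverse (V p.2.2.1) * Ring.inverse (V p.2.2.2) - 1‖ < ε},
        V ∈ K z ∧ T z V V = V) ∧
      (∀ z : Z, ∀ V ∈ {V : B → 𝔄 | (∀ b, IsUnit (V b)) ∧ ∀ p ∈ plaqs,
          ‖V p.1 * V p.2.1 * Ring.inverse (V p.2.2.1) * Ring.inverse (V p.2.2.2) - 1‖ < ε},
        ∀ x ∈ K z, ∀ y ∈ K z, ‖T z V x - T z V y‖ ≤ q * ‖x - y‖) ∧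
      (∀ z : Z, ∀ V ∈ {V : B → 𝔄 | (∀ b, IsUnit (V b)) ∧ ∀ p ∈ plaqs,
          ‖V p.1 * V p.2.1 * Ring.inverse (V p.2.2.1) * Ring.inverse (V p.2.2.2) - 1‖ < ε},
        ContDiffAt ℂ ω (fun w : (B → 𝔄) × (B → 𝔄) => T z w.1 w.2) (V, V)) ∧
      (∀ z : Z, ∀ V ∈ {V : B → 𝔄 | (∀ b, IsUnit (V b)) ∧ ∀ p ∈ plaqs,
          ‖V p.1 * V p.2.1 * Ring.inverse (V p.2.2.1) * Ring.inverse (V p.2.2.2) - 1‖ < ε}, K z ∈ 𝓝 V) ∧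
      (∀ z : Z, ∀ V ∈ {V : B → 𝔄 | (∀ b, IsUnit (V b)) ∧ ∀ p ∈ plaqs,
          ‖V p.1 * V p.2.1 * Ring.inverse (V p.2.2.1) * Ring.inverse (V p.2.2.2) - 1‖ < ε}, ∀ b, IsUnit (V b)) := by
  refine ⟨fun _ V U => (2 : ℂ)⁻¹ • U + (2 : ℂ)⁻¹ • V, fun _ => univ, 1 / 2, by norm_num,
    fun _ V _ => ⟨mem_univ _, ?_⟩, fun _ V _ x _ y _ => ?_, fun _ V _ => ?_, fun _ V _ => univ_mem, fun _ V hV => hV.1⟩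
  · -- the fixed-point identity `½V + ½V = V`
    show (2 : ℂ)⁻¹ • V + (2 : ℂ)⁻¹ • V = V
    rw [← add_smul]; norm_num
  · -- the contraction letter `q = ½`
    show ‖(2 : ℂ)⁻¹ • x + (2 : ℂ)⁻¹ • V - ((2 : ℂ)⁻¹ • y + (2 : ℂ)⁻¹ • V)‖ ≤ 1 / 2 * ‖x - y‖
    have h : (2 : ℂ)⁻¹ • x + (2 : ℂ)⁻¹ • V - ((2 : ℂ)⁻¹ • y + (2 : ℂ)⁻¹ • V) = (2 : ℂ)⁻¹ • (x - y) := by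
      rw [smul_sub]; abel
    rw [h, norm_smul]
    norm_num
  · -- joint analyticity: the family is a continuous linear map of `(V, U)`
    exact ((contDiff_snd.const_smul (2 : ℂ)⁻¹).add (contDiff_fst.const_smul (2 : ℂ)⁻¹)).contDiffAt

end Witness

end Summit.QuantumFields.YangMills.Theorems.N21MinimiserResponseContractionInterior
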